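import Mathlib.NumberTheory.ArithmeticFunction.Liouville
import Literature.NumberTheory.Sieve.MatomakiRadziwill
import Summits.ValiantsHypothesis.ValiantsHypothesis.Theorems.LiouvilleSarnakAlignedTypeITransposedPrelims
import HarnessLib

/-!
# Route LiouvilleSarnak — `AlignedTypeI` (stmt-ValiantsHypothesis-21040): the TRANSPOSED rung from
# Matomäki–Radziwiłł (interval side of the aligned cut)

The support item `AlignedTypeI` asks for `Σ_{a<2^n} |Σ_{b<2^n} λ(a + 2^n b + 1)| ≤ ε 4^n`: `ℓ¹`-cancellation of the
Liouville function over the residue classes `a + 1 (mod 2^n)` among the integers `≤ 4^n` — the rank-one test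
`u = signs, w ≡ 1` of the held crux `DigitalBilinearLiouville` (stmt-14774) on the ALIGNED cut (low digits `a` = rows,
high digits `b` = columns).  Hands g0–g2 on this item showed that the registered line `characters_mod_2n` is the crux
itself (`kmtVariance_iff_alignedTypeI`) and closed it MODULO the named fact
`Literature.NumberTheory.LFunctions.KMT2023_theorem13_liouville_twoPower` (Klurman–Mangerel–Teräväinen 2023, Thm 1.3:
multiplicative functions in arithmetic progressions to smooth moduli `q ≤ √x`), which is not proved in the tree.

This file proves, UNCONDITIONALLY modulo the tree's proof of Matomäki–Radziwiłł, the TRANSPOSED rung — the other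
rank-one test `u ≡ 1, w = signs` of the same matrix:

  `alignedTypeI_transposed_of_MR : MatomakiRadziwill2016_theorem1 →`
  `  ∀ ε > 0, ∃ n₀, ∀ n ≥ n₀, Σ_{b<2^n} |Σ_{a<2^n} λ(a + 2^n b + 1)| ≤ ε · 4^n`,

where the inner sums now run over the INTERVALS `[2^n b + 1, 2^n (b+1)]` of length `2^n = √x`.  The hypothesis is the
named fact `Literature.NumberTheory.Sieve.MatomakiRadziwill2016_theorem1` (Matomäki–Radziwiłł, Ann. Math. 2016,
Theorem 1, as printed), which is PROVED in the tree (`Literature.NumberTheory.Sieve.MatomakiRadziwill2016_theorem1_holds`,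
file `MatomakiRadziwillProofs.lean`, from Vinogradov's mean value theorem upward); it is taken as a hypothesis here only
to keep this file's imports light — the one-line discharge lives in the companion file
`LiouvilleSarnakAlignedTypeITransposedHolds.lean`.

## Contents

* (§1, file `…TransposedPrelims.lean`) bookkeeping: `|Σ_{n∈s} λ| ≤ #s`; block sums as interval sums; a block
  `[s, s+h)` and the window `[s+u, s+u+h]` differ by `≤ 2u+1` terms; distinct thickened block starts `hb + 1 + u`
  (`u ≤ t < h`) are distinct integers; the prime number theorem for `λ` and the threshold `h₀` in usable form.
* §2 `sum_abs_blockSum_le_of_MR`: for every `ε > 0` there is `h₀` with `Σ_{b<B} |Σ_{a<h} λ(a + hb + 1)| ≤ ε h B` for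
  all `h ≥ h₀` and ALL `B` — the `ℓ¹`-over-blocks form of "λ has `o(h)` sum in almost all intervals of length `h`".
  Proof: Theorem 1 with `X = h 2^j` (dyadic range of the block start), `δ ≍ ε`, windows starting at the `t+1 = ⌊δh⌋+1`
  integers right of each block start; non-exceptional windows have sum `≤ (2δ + X⁻¹|Σ_{X≤n≤2X} λ|) h ≤ 3δh` by the
  prime number theorem for `λ` (`Literature.NumberTheory.LFunctions.abs_sum_liouville_le_logPow`, PROVED); exceptional
  windows number `≤ C X ρ(h)` per dyadic range with `ρ(h) → 0`, costing `≤ 4Cρ(h)/δ · hB` in total; block `b = 0` is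
  the prime number theorem.
* §3 `sum_abs_dyadicBlockSum_le_of_MR` (`h = 2^n`, any `B`: both parities of the top level, cf.
  `alignedTypeI_iff_topTwoLevels` of `…CharactersMod2nStubIsCrux.lean`) and `alignedTypeI_transposed_of_MR` (`B = 2^n`,
  literally `AlignedTypeI` with the two digit blocks exchanged).

HONEST FRAMING.  This is the EASY side of the aligned cut: intervals of length `√x` (Matomäki–Radziwiłł, in fact far
below their range) versus progressions of modulus `√x` (the item, KMT-hard).  Nothing here closes `AlignedTypeI`, its
registered stubs, or `DigitalBilinearLiouville` (for which both rank-one tests are necessary); `VP ≠ VNP` is NOT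
touched.  Landed `--supports stmt-ValiantsHypothesis-21040` as the w-side calibration flagged "provable now, not done"
by hand g2 (REQUESTS.md 2026-08-31T09:19:49Z).

## References
* K. Matomäki, M. Radziwiłł, *Multiplicative functions in short intervals*, Ann. of Math. 183 (2016), Theorem 1.
  [MatomakiRadziwillAnnals2016]
-/

set_option linter.dupNamespace false

noncomputable section

namespace Summit.ValiantsHypothesis.ValiantsHypothesis.Theorems.LiouvilleSarnak.AlignedTypeI.Transposed

open ArithmeticFunction Finset Filter
open Literature.NumberTheory.Sieve Literature.NumberTheory.LFunctions

/-! ## §2 Blocks of length `h → ∞`: `∑_b |∑_{a<h} λ(a + h b + 1)| = o(h B)` from Matomäki–Radziwiłł -/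

/-- **`ℓ¹` over blocks, from Matomäki–Radziwiłł Theorem 1.**  Assuming the named fact
`MatomakiRadziwill2016_theorem1` (PROVED in tree: `MatomakiRadziwill2016_theorem1_holds`): for every `ε > 0`
there is `h₀` such that for all `h ≥ h₀` and all `B`,
`∑_{b < B} |∑_{a < h} λ(a + h b + 1)| ≤ ε h B` — the Liouville function has `o(h)` sum on all but `o(B)` of
the `B` consecutive blocks of length `h` tiling `[1, hB]`, in `ℓ¹` form, uniformly in `B`.
Proof: thicken each block start `hb + 1` (`b ≥ 1`, dyadic range `hb ∈ [h2^j, h2^{j+1})`) by `t = ⌊δh⌋`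
window starts `x = hb + 1 + u`, `u ≤ t`; a window `[x, x+h]` differs from the block by `≤ 2u + 1 ≤ 2δh + 1`
terms; a non-exceptional `x` (Theorem 1 with `X = h2^j`, `δ`) has window sum `≤ (2δ + X⁻¹|∑_{X≤n≤2X} λ|) h ≤ 3δh`
by the prime number theorem for `λ`; the exceptional `x` number `≤ C X ρ(h)` per dyadic range with `ρ(h) → 0`,
and distinct `(b, u)` give distinct `x` (`t < h`), so they cost `≤ (h+1)/(t+1) · C ρ(h) · 2hB ≤ 4Cρ(h)/δ · hB`
in total; the block `b = 0` is the prime number theorem. [cite: MatomakiRadziwillAnnals2016, Theorem 1] -/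
theorem sum_abs_blockSum_le_of_MR (hMR : MatomakiRadziwill2016_theorem1) {ε : ℝ} (hε : 0 < ε) :
    ∃ h₀ : ℕ, ∀ h : ℕ, h₀ ≤ h → ∀ B : ℕ,
      ∑ b ∈ range B, |∑ a ∈ range h, (liouville (a + h * b + 1) : ℝ)| ≤ ε * h * B := by
  obtain ⟨C, C', hC, hC', H⟩ := hMR
  have hC0 : 0 < C := by linarith
  -- the working tolerance `δ`
  set δ : ℝ := min (ε / 16) (1 / 4) with hδ_def
  have hδ : 0 < δ := by positivity
  have hδε : δ ≤ ε / 16 := min_le_left _ _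
  have hδ4 : δ ≤ 1 / 4 := min_le_right _ _
  -- the prime number theorem for `λ` in the form `|L(y)| ≤ (δ/3) y` for `y ≥ y₀`
  obtain ⟨y₀, hy₀2, hPNT⟩ := exists_pnt_threshold (η := δ / 3) (by positivity)
  -- the exceptional-set density `ρ(h)` of Theorem 1 (with `log X` replaced by `log h ≤ log X`) and the threshold
  set ρ : ℕ → ℝ := fun h => Real.log h ^ (1 / 3 : ℝ) / (δ ^ 2 * (h : ℝ) ^ (δ / 25))
      + 1 / (δ ^ 2 * Real.log h ^ (1 / 50 : ℝ)) with hρ_def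
  obtain ⟨h₀, hh₀⟩ := exists_blocks_threshold C C' y₀ hδ
  refine ⟨h₀, fun h hh B => ?_⟩
  obtain ⟨c1, c2, c3, c4'⟩ := hh₀ h hh
  have c4 : C * ρ h ≤ δ ^ 2 := by simpa only [hρ_def] using c4'
  -- basic size facts about `h`
  have hh3R : (3 : ℝ) ≤ h := by linarith
  have hh3 : 3 ≤ h := by exact_mod_cast hh3R
  have hhpos : (0 : ℝ) < h := by linarith
  have hlogh : 0 < Real.log h := Real.log_pos (by linarith)
  -- the real Liouville function as a multiplicative arithmetic function
  set f : ArithmeticFunction ℝ := ((liouville : ArithmeticFunction ℤ) : ArithmeticFunction ℝ) with hf_def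
  have hfm : f.IsMultiplicative := isMultiplicative_liouville.intCast
  have hfap : ∀ n, f n = (liouville n : ℝ) := fun n => ArithmeticFunction.intCoe_apply
  have hf1 : ∀ n, |f n| ≤ 1 := fun n => by rw [hfap]; exact LiouvilleSum.abs_liouville_le_one n
  -- the thickening parameter `t = ⌊δ h⌋`, `δ h - 1 < t ≤ δ h`, `t < h`
  set t : ℕ := ⌊δ * h⌋₊ with ht_def
  have ht_le : (t : ℝ) ≤ δ * h := Nat.floor_le (by positivity)
  have ht_lt : δ * h < t + 1 := Nat.lt_floor_add_one _
  have hthR : (t : ℝ) < h := by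
    have := mul_lt_mul_of_pos_right (show δ < 1 by linarith) hhpos
    rw [one_mul] at this
    exact lt_of_le_of_lt ht_le this
  have hth : t < h := by exact_mod_cast hthR
  have ht1 : (0 : ℝ) < t + 1 := by positivity
  -- the exceptional sets `E m` of Theorem 1 at `X = m ≥ h` and their size
  set r : ℝ := C' * Real.log (Real.log h) / Real.log h with hr_def
  set E : ℕ → Finset ℕ := fun m => {x ∈ Icc m (2 * m) | δ + r <
      |(h : ℝ)⁻¹ * ∑ n ∈ Icc x (x + h), (liouville n : ℝ)
        - (m : ℝ)⁻¹ * ∑ n ∈ Icc m (2 * m), (liouville n : ℝ)|} with hE_def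
  have key : ∀ m : ℕ, h ≤ m → (#(E m) : ℝ) ≤ C * m * ρ h := by
    intro m hm
    have hmR : (h : ℝ) ≤ m := by exact_mod_cast hm
    have hm0 : (0 : ℝ) < m := hhpos.trans_le hmR
    have hlogm : Real.log h ≤ Real.log m := Real.log_le_log hhpos hmR
    have := H f hfm hf1 (h : ℝ) (m : ℝ) δ (by linarith) hmR hδ
    have e1 : ⌈(m : ℝ)⌉₊ = m := Nat.ceil_natCast _
    have e2 : ⌊2 * (m : ℝ)⌋₊ = 2 * m := by
      rw [show (2 : ℝ) * (m : ℝ) = ((2 * m : ℕ) : ℝ) by push_cast; ring]; exact Nat.floor_natCast _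
    have e3 : ⌊(h : ℝ)⌋₊ = h := Nat.floor_natCast _
    simp only [e1, e2, e3, hfap] at this
    refine this.trans ?_
    have hρ : Real.log h ^ (1 / 3 : ℝ) / (δ ^ 2 * (h : ℝ) ^ (δ / 25))
        + 1 / (δ ^ 2 * Real.log m ^ (1 / 50 : ℝ)) ≤ ρ h := by
      simp only [hρ_def]
      gcongr
    exact mul_le_mul_of_nonneg_left hρ (by positivity)
  -- the long sums `∑_{m ≤ n ≤ 2m} λ(n)` are `≤ δ m` by the prime number theorem
  have long : ∀ m : ℕ, h ≤ m → |∑ n ∈ Icc m (2 * m), (liouville n : ℝ)| ≤ δ * m := by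
    intro m hm
    have hm1 : 1 ≤ m := le_trans (by omega) hm
    have hmR : (h : ℝ) ≤ m := by exact_mod_cast hm
    have hsplit : ∑ n ∈ Icc m (2 * m), (liouville n : ℝ)
        = ∑ n ∈ Ioc 0 (2 * m), (liouville n : ℝ) - ∑ n ∈ Ioc 0 (m - 1), (liouville n : ℝ) := by
      rw [show m = (m - 1) + 1 from (Nat.sub_add_cancel hm1).symm, Finset.Icc_add_one_left_eq_Ioc,
        Nat.add_sub_cancel, ← sum_Ioc_consecutive _ (Nat.zero_le (m - 1)) (by omega)]
      ring
    have hA := hPNT ((2 * m : ℕ) : ℝ) (by push_cast; linarith)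
    have hB' := hPNT ((m - 1 : ℕ) : ℝ) (by rw [Nat.cast_sub hm1]; push_cast; linarith)
    rw [Nat.floor_natCast] at hA hB'
    rw [hsplit]
    calc |∑ n ∈ Ioc 0 (2 * m), (liouville n : ℝ) - ∑ n ∈ Ioc 0 (m - 1), (liouville n : ℝ)|
        ≤ |∑ n ∈ Ioc 0 (2 * m), (liouville n : ℝ)| + |∑ n ∈ Ioc 0 (m - 1), (liouville n : ℝ)| :=
          abs_sub _ _
      _ ≤ δ / 3 * ((2 * m : ℕ) : ℝ) + δ / 3 * ((m - 1 : ℕ) : ℝ) := add_le_add hA hB'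
      _ ≤ δ * m := by
          rw [Nat.cast_sub hm1]; push_cast; linarith
  -- window sums: `≤ 3δh` off the exceptional set, `≤ h + 1` on it
  have window : ∀ m : ℕ, h ≤ m → ∀ x ∈ Icc m (2 * m),
      |∑ n ∈ Icc x (x + h), (liouville n : ℝ)| ≤ 3 * δ * h + (h + 1) * (if x ∈ E m then 1 else 0) := by
    intro m hm x hx
    have hmR : (h : ℝ) ≤ m := by exact_mod_cast hm
    have hm0 : (0 : ℝ) < m := hhpos.trans_le hmR
    by_cases hxE : x ∈ E m
    · rw [if_pos hxE, mul_one]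
      calc |∑ n ∈ Icc x (x + h), (liouville n : ℝ)| ≤ #(Icc x (x + h)) := abs_sum_liouville_le_card _
        _ = h + 1 := by rw [Nat.card_Icc]; push_cast [show x + h + 1 - x = h + 1 by omega]; ring
        _ ≤ 3 * δ * h + (h + 1) := by
            have : (0 : ℝ) ≤ 3 * δ * h := by positivity
            linarith
    · rw [if_neg hxE, mul_zero, add_zero]
      have hgood : |(h : ℝ)⁻¹ * ∑ n ∈ Icc x (x + h), (liouville n : ℝ)
          - (m : ℝ)⁻¹ * ∑ n ∈ Icc m (2 * m), (liouville n : ℝ)| ≤ δ + r := by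
        by_contra hcon
        exact hxE (mem_filter.2 ⟨hx, lt_of_not_ge hcon⟩)
      have hA : |(m : ℝ)⁻¹ * ∑ n ∈ Icc m (2 * m), (liouville n : ℝ)| ≤ δ := by
        rw [abs_mul, abs_inv, abs_of_pos hm0, inv_mul_le_iff₀ hm0]
        exact (long m hm).trans (le_of_eq (mul_comm _ _))
      have h3 : |(h : ℝ)⁻¹ * ∑ n ∈ Icc x (x + h), (liouville n : ℝ)| ≤ 3 * δ := by
        have := abs_sub_abs_le_abs_sub ((h : ℝ)⁻¹ * ∑ n ∈ Icc x (x + h), (liouville n : ℝ))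
          ((m : ℝ)⁻¹ * ∑ n ∈ Icc m (2 * m), (liouville n : ℝ))
        linarith
      rw [abs_mul, abs_inv, abs_of_pos hhpos, inv_mul_le_iff₀ hhpos] at h3
      linarith
  -- per block `b ≥ 1`: thickened average, with `K = (h+1)/(t+1)`
  set K : ℝ := ((h : ℝ) + 1) / (t + 1) with hK_def
  have block : ∀ b : ℕ, 1 ≤ b →
      |∑ a ∈ range h, (liouville (a + h * b + 1) : ℝ)| ≤ 3 * δ * h + (2 * t + 1)
        + K * ∑ u ∈ range (t + 1),
            (if h * b + 1 + u ∈ E (h * 2 ^ Nat.log 2 b) then (1 : ℝ) else 0) := by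
    intro b hb
    set j : ℕ := Nat.log 2 b with hj_def
    have hbj : 2 ^ j ≤ b := Nat.pow_log_le_self 2 (by omega)
    have hbj' : b < 2 ^ (j + 1) := Nat.lt_pow_succ_log_self one_lt_two b
    have hm : h ≤ h * 2 ^ j := Nat.le_mul_of_pos_right h (by positivity)
    -- the block as an interval sum
    have hS : ∑ a ∈ range h, (liouville (a + h * b + 1) : ℝ)
        = ∑ n ∈ Ico (h * b + 1) (h * b + 1 + h), (liouville n : ℝ) := by
      rw [← sum_range_shift_eq_sum_Ico (fun n => (liouville n : ℝ)) (h * b + 1) h]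
      exact sum_congr rfl fun a _ => by rw [add_assoc]
    -- each thickened window controls the block
    have hu : ∀ u ∈ range (t + 1), |∑ a ∈ range h, (liouville (a + h * b + 1) : ℝ)|
        ≤ 3 * δ * h + (2 * t + 1)
          + (h + 1) * (if h * b + 1 + u ∈ E (h * 2 ^ j) then (1 : ℝ) else 0) := by
      intro u hu
      have hut : u ≤ t := Nat.lt_succ_iff.mp (mem_range.1 hu)
      have hx : h * b + 1 + u ∈ Icc (h * 2 ^ j) (2 * (h * 2 ^ j)) := by
        rw [mem_Icc]
        constructor
        · exact le_trans (Nat.mul_le_mul_left h hbj) (by rw [add_assoc]; exact Nat.le_add_right _ _)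
        · have h1 : h * (b + 1) ≤ h * 2 ^ (j + 1) := Nat.mul_le_mul_left h hbj'
          have h2 : u + 1 ≤ h := by omega
          calc h * b + 1 + u ≤ h * b + h := by omega
            _ = h * (b + 1) := by ring
            _ ≤ h * 2 ^ (j + 1) := h1
            _ = 2 * (h * 2 ^ j) := by ring
      have hw := window (h * 2 ^ j) hm _ hx
      have hd := abs_blockSum_sub_windowSum_le (h * b + 1) h u (by omega)
      rw [← hS] at hd
      have := abs_sub_abs_le_abs_sub (∑ a ∈ range h, (liouville (a + h * b + 1) : ℝ))
        (∑ n ∈ Icc (h * b + 1 + u) (h * b + 1 + u + h), (liouville n : ℝ))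
      have hutR : (u : ℝ) ≤ t := by exact_mod_cast hut
      linarith
    have hsum := sum_le_sum hu
    rw [sum_const, card_range, nsmul_eq_mul, sum_add_distrib, sum_const, card_range, nsmul_eq_mul,
      ← mul_sum] at hsum
    push_cast at hsum
    calc |∑ a ∈ range h, (liouville (a + h * b + 1) : ℝ)|
        = (t + 1 : ℝ) * |∑ a ∈ range h, (liouville (a + h * b + 1) : ℝ)| / (t + 1) :=
          (mul_div_cancel_left₀ _ ht1.ne').symm
      _ ≤ ((t + 1) * (3 * δ * h + (2 * t + 1)) + (h + 1) * ∑ u ∈ range (t + 1),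
            (if h * b + 1 + u ∈ E (h * 2 ^ j) then (1 : ℝ) else 0)) / (t + 1) := by
          gcongr
      _ = 3 * δ * h + (2 * t + 1) + K * ∑ u ∈ range (t + 1),
            (if h * b + 1 + u ∈ E (h * 2 ^ j) then (1 : ℝ) else 0) := by
          rw [hK_def, add_div, mul_div_cancel_left₀ _ ht1.ne', div_mul_eq_mul_div]
  -- summing the exceptional counts over `1 ≤ b < B`, fiberwise in `j = log₂ b`
  have count : ∀ B : ℕ, 1 ≤ B →
      ∑ b ∈ Ico 1 B, ∑ u ∈ range (t + 1),
          (if h * b + 1 + u ∈ E (h * 2 ^ Nat.log 2 b) then (1 : ℝ) else 0)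
        ≤ C * ρ h * (2 * h * B) := by
    intro B hB
    set J : ℕ := Nat.log 2 B + 1 with hJ_def
    have hmaps : ∀ b ∈ Ico 1 B, Nat.log 2 b ∈ range J := fun b hb =>
      mem_range.2 (Nat.lt_succ_of_le (Nat.log_mono_right (mem_Ico.1 hb).2.le))
    rw [← sum_fiberwise_of_maps_to hmaps]
    have hfib : ∀ j ∈ range J,
        ∑ b ∈ Ico 1 B with Nat.log 2 b = j, ∑ u ∈ range (t + 1),
            (if h * b + 1 + u ∈ E (h * 2 ^ Nat.log 2 b) then (1 : ℝ) else 0)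
          ≤ C * (h * 2 ^ j) * ρ h := by
      intro j _
      calc ∑ b ∈ Ico 1 B with Nat.log 2 b = j, ∑ u ∈ range (t + 1),
            (if h * b + 1 + u ∈ E (h * 2 ^ Nat.log 2 b) then (1 : ℝ) else 0)
          = ∑ b ∈ Ico 1 B with Nat.log 2 b = j, ∑ u ∈ range (t + 1),
            (if h * b + 1 + u ∈ E (h * 2 ^ j) then (1 : ℝ) else 0) :=
            sum_congr rfl fun b hb => by rw [(mem_filter.1 hb).2]
        _ ≤ #(E (h * 2 ^ j)) := sum_sum_indicator_le_card _ _ hth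
        _ ≤ C * ((h * 2 ^ j : ℕ) : ℝ) * ρ h := key _ (Nat.le_mul_of_pos_right h (by positivity))
        _ = C * (h * 2 ^ j) * ρ h := by push_cast; ring
    refine (sum_le_sum hfib).trans ?_
    have hg2 : ∑ j ∈ range J, (2 : ℝ) ^ j = 2 ^ J - 1 := by
      rw [geom_sum_eq (by norm_num) J]
      norm_num
    have hgeom : ∑ j ∈ range J, C * ((h : ℝ) * 2 ^ j) * ρ h = C * ρ h * h * (2 ^ J - 1) := by
      rw [← hg2, mul_sum]
      exact sum_congr rfl fun j _ => by ring
    rw [hgeom]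
    have hJB : (2 : ℝ) ^ J ≤ 2 * B := by
      have : 2 ^ J ≤ 2 * B := by
        rw [hJ_def, pow_succ]
        have := Nat.pow_log_le_self 2 (by omega : B ≠ 0)
        omega
      exact_mod_cast this
    have hx : (2 : ℝ) ^ J - 1 ≤ 2 * B := by linarith
    calc C * ρ h * h * (2 ^ J - 1) ≤ C * ρ h * h * (2 * B) :=
          mul_le_mul_of_nonneg_left hx (by positivity)
      _ = C * ρ h * (2 * h * B) := by ring
  -- assembly
  rcases Nat.eq_zero_or_pos B with hB0 | hBpos
  · subst hB0; simp
  have hB1 : (1 : ℝ) ≤ B := by exact_mod_cast hBpos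
  -- the block `b = 0`
  have hzero : |∑ a ∈ range h, (liouville (a + h * 0 + 1) : ℝ)| ≤ δ / 3 * h := by
    have e : ∑ a ∈ range h, (liouville (a + h * 0 + 1) : ℝ) = ∑ n ∈ Ioc 0 h, (liouville n : ℝ) := by
      simp only [mul_zero, add_zero]
      rw [sum_range_shift_eq_sum_Ico (fun n => (liouville n : ℝ)) 1 h]
      congr 1
      ext n
      simp only [mem_Ico, mem_Ioc]
      omega
    have := hPNT (h : ℝ) (by linarith)
    rw [Nat.floor_natCast] at this
    rw [e]; exact this
  rw [range_eq_Ico, sum_eq_sum_Ico_succ_bot hBpos]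
  have hrest : ∑ b ∈ Ico 1 B, |∑ a ∈ range h, (liouville (a + h * b + 1) : ℝ)|
      ≤ ∑ b ∈ Ico 1 B, (3 * δ * h + (2 * t + 1)
        + K * ∑ u ∈ range (t + 1),
            (if h * b + 1 + u ∈ E (h * 2 ^ Nat.log 2 b) then (1 : ℝ) else 0)) :=
    sum_le_sum fun b hb => block b (mem_Ico.1 hb).1
  rw [sum_add_distrib, sum_const, Nat.card_Ico, nsmul_eq_mul, ← mul_sum] at hrest
  have hcnt := count B hBpos
  have hK0 : 0 ≤ K := by positivity
  have hKle : K ≤ 2 / δ := by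
    rw [hK_def, div_le_div_iff₀ ht1 hδ]
    have e : ((h : ℝ) + 1) * δ = δ * h + δ := by ring
    rw [e]
    linarith
  have hBR : ((B - 1 : ℕ) : ℝ) ≤ B := by
    rw [Nat.cast_sub (by omega)]; push_cast; linarith
  have hpos1 : 0 ≤ 3 * δ * h + (2 * (t : ℝ) + 1) := by positivity
  -- collect: `δ/3 h + B (3δh + 2t + 1) + K · Cρ · 2hB ≤ 11 δ h B ≤ ε h B`
  have hKC : K * (C * ρ h * (2 * h * B)) ≤ 4 * δ * h * B := by
    calc K * (C * ρ h * (2 * h * B)) ≤ (2 / δ) * (δ ^ 2 * (2 * h * B)) :=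
          mul_le_mul hKle (mul_le_mul_of_nonneg_right c4 (by positivity)) (by positivity)
            (by positivity)
      _ = 4 * δ * h * B := by field_simp; ring
  have hmid : ((B - 1 : ℕ) : ℝ) * (3 * δ * h + (2 * t + 1)) ≤ B * (6 * δ * h) := by
    have : 3 * δ * h + (2 * (t : ℝ) + 1) ≤ 6 * δ * h := by linarith
    exact mul_le_mul hBR this hpos1 (by positivity)
  have hKsum : K * ∑ b ∈ Ico 1 B, ∑ u ∈ range (t + 1),
      (if h * b + 1 + u ∈ E (h * 2 ^ Nat.log 2 b) then (1 : ℝ) else 0) ≤ 4 * δ * h * B :=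
    (mul_le_mul_of_nonneg_left hcnt hK0).trans hKC
  have hδhB : δ / 3 * h ≤ δ * h * B := by
    have := mul_le_mul_of_nonneg_left hB1 (show (0 : ℝ) ≤ δ * h by positivity)
    linarith
  calc |∑ a ∈ range h, (liouville (a + h * 0 + 1) : ℝ)|
        + ∑ b ∈ Ico (0 + 1) B, |∑ a ∈ range h, (liouville (a + h * b + 1) : ℝ)|
      ≤ δ / 3 * h + (B * (6 * δ * h) + 4 * δ * h * B) := by
        rw [zero_add]
        exact add_le_add hzero (hrest.trans (add_le_add hmid hKsum))
    _ ≤ 11 * δ * h * B := by linarith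
    _ ≤ ε * h * B := by
        have h11 : 11 * δ ≤ ε := by linarith
        have := mul_le_mul_of_nonneg_right h11 (show (0 : ℝ) ≤ h * B by positivity)
        linarith


/-! ## §3 The transposed rung of `AlignedTypeI` -/

/-- **Dyadic blocks, any number of them.**  Assuming `MatomakiRadziwill2016_theorem1`: for every `ε > 0` there is
`n₀` such that for all `n ≥ n₀` and all `B`, `∑_{b < B} |∑_{a < 2^n} λ(a + 2^n b + 1)| ≤ ε 2^n B` (the case
`h = 2^n` of `sum_abs_blockSum_le_of_MR`; `B = 2^n` is the transposed rung, `B = 2^{n+1}` its odd-level twin).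
[cite: MatomakiRadziwillAnnals2016, Theorem 1] -/
theorem sum_abs_dyadicBlockSum_le_of_MR (hMR : MatomakiRadziwill2016_theorem1) {ε : ℝ} (hε : 0 < ε) :
    ∃ n₀ : ℕ, ∀ n : ℕ, n₀ ≤ n → ∀ B : ℕ,
      ∑ b ∈ range B, |∑ a ∈ range (2 ^ n), (liouville (a + 2 ^ n * b + 1) : ℝ)| ≤ ε * 2 ^ n * B := by
  obtain ⟨h₀, H⟩ := sum_abs_blockSum_le_of_MR hMR hε
  refine ⟨h₀, fun n hn B => ?_⟩
  have hh : h₀ ≤ 2 ^ n := le_trans hn Nat.lt_two_pow_self.le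
  have := H (2 ^ n) hh B
  push_cast at this
  exact this

/-- **The TRANSPOSED rung of `AlignedTypeI`, conditional form.**  Assuming the named fact
`MatomakiRadziwill2016_theorem1` (Matomäki–Radziwiłł 2016, Theorem 1 — PROVED in the tree as
`Literature.NumberTheory.Sieve.MatomakiRadziwill2016_theorem1_holds`, whose import is kept out of this file only to
keep its build light): for every `ε > 0` there is `n₀` with
`∑_{b < 2^n} |∑_{a < 2^n} λ(a + 2^n b + 1)| ≤ ε · 4^n` for all `n ≥ n₀`.
This is the statement `AlignedTypeI` of the route with the roles of the two digit blocks exchanged: the inner sum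
runs over the LOW `n` binary digits `a` (an interval of length `2^n = √x`), the outer `ℓ¹`-average over the HIGH
digits `b`; i.e. the rank-one test `u ≡ 1`, `w = signs` of the crux `DigitalBilinearLiouville` on the aligned cut,
where `AlignedTypeI` is the test `u = signs`, `w ≡ 1`. [cite: MatomakiRadziwillAnnals2016, Theorem 1] -/
theorem alignedTypeI_transposed_of_MR (hMR : MatomakiRadziwill2016_theorem1) :
    ∀ ε : ℝ, 0 < ε → ∃ n₀ : ℕ, ∀ n ≥ n₀,
      ∑ b : Fin (2 ^ n), |∑ a : Fin (2 ^ n),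
        ((ArithmeticFunction.liouville ((a : ℕ) + 2 ^ n * (b : ℕ) + 1) : ℤ) : ℝ)| ≤ ε * 4 ^ n := by
  intro ε hε
  obtain ⟨n₀, H⟩ := sum_abs_dyadicBlockSum_le_of_MR hMR hε
  refine ⟨n₀, fun n hn => ?_⟩
  have := H n hn (2 ^ n)
  simp only [Finset.sum_range] at this
  have e : ε * (4 : ℝ) ^ n = ε * 2 ^ n * ((2 ^ n : ℕ) : ℝ) := by
    push_cast
    rw [show (4 : ℝ) = 2 * 2 by norm_num, mul_pow]
    ring
  rw [e]
  exact this

end Summit.ValiantsHypothesis.ValiantsHypothesis.Theorems.LiouvilleSarnak.AlignedTypeI.Transposed
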